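import Literature.NumberTheory.Automorphic.UnitaryGroupIsotropicLineElements
import HarnessLib

/-!
# The symplectic chart of `Res_{S/R} Sⁿ` adapted to a hyperbolic frame of a hermitian space

Topic `NumberTheory/Automorphic`; namespace `Literature.NumberTheory.Automorphic.UnitaryGroup` (continuing
`QuadraticRestrictionOfScalars`, `UnitaryGroupSymplecticEmbedding`).  KERNEL ONLY: theorems, no definition, no named fact,
no `sorry`.

Setting: quadratic coordinates `h : IsQuadraticCoordinates φ Ψ δ d` (`S = φ(R) ⊕ φ(R) δ`, `δ² = φ d`, `R` a field), a
conjugation `σ` (`σ ∘ φ = φ`, `σ δ = -δ`, `σ ∘ σ = id`), an `R`-rational symmetric Gram matrix `T` and the hermitian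
pairing `B(x, y) = (σ x)ᵀ (T ⊗ 1) y` on `Sⁿ` (`hermForm`); a HYPERBOLIC FRAME `(x₀, y₀, (bⱼ)_{j < m}, (aⱼ))`: `B x₀ x₀ =
B y₀ y₀ = 0`, `B x₀ y₀ = 1`, `bⱼ ⊥ x₀, y₀`, `B bⱼ bⱼ' = 0` (`j ≠ j'`), `B bⱼ bⱼ = φ aⱼ`, `aⱼ ≠ 0`, with the expansion
`v = (B y₀ v) x₀ + (B x₀ v) y₀ + Σⱼ φ(aⱼ⁻¹) (B bⱼ v) bⱼ` (such frames exist through any isotropic vector when `S` is a field: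
`Literature.LinearAlgebra.Semilinear.exists_hyperbolicFrame`).

* §1 algebra of `hermForm` (sums in each variable, hermitian symmetry for `H = T ⊗ 1`; additivity and
  `σ`-sesquilinearity are the tree's `UnitaryGroupIsotropicLineElements` / `UnitaryCayleyMomentMap`);
* §2 **`exists_frameChart`** — the ADAPTED SYMPLECTIC CHART: an `R`-linear isomorphism
  `Γ : Rⁿ × Rⁿ ≃ R^ι × R^ι`, `ι = Fin 2 ⊔ Fin m`, with
  `Γ(reIm v) = ((re B(x₀,v), im B(x₀,v)) ⊔ (aⱼ⁻¹ re B(bⱼ,v))ⱼ ; (im B(y₀,v), -re B(y₀,v)) ⊔ (im B(bⱼ,v))ⱼ)`,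
  carrying the commutator form `im B = alt (polar β_T)` of `Res Sⁿ` (`im_hermForm_map`) to the STANDARD form
  `alt (polar ⟨·,·⟩)` of `R^ι × R^ι` — the isotropic line `S x₀` goes to the modulation directions `0 × (R² × 0)`, its
  hyperbolic partner `S y₀` to the translation directions `(R² × 0) × 0`, and `Res(⊕ S bⱼ)` to the remaining standard
  symplectic coordinates ([MoeglinVignerasWaldspurger1987, Chap. 3 §IV.2]: the complete polarisation of `𝕎 = Res(V ⊗ W)`
  through `X' ⊗ W` used for the mixed model).

The action of the parabolic of the line in this chart is in `UnitaryGroupIsotropicFrameElements.lean`.  Written for the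
cell `hodgecm-mathlib` (fan B, rung B-IV), second route to `mvw_IV4_rankOne_irreducibleOrZero`.

## References
* [MoeglinVignerasWaldspurger1987] C. Mœglin, M.-F. Vignéras, J.-L. Waldspurger, LNM 1291 (1987), Chap. 1 I.17, Chap. 3 §IV.2.
* [GelbartRogawski1991] S. Gelbart, J. Rogawski, Invent. Math. 105 (1991), §3.1 p. 454 (`W = Res_{E/F} V`).
* [Mok2014] C. P. Mok, Mem. AMS 235 (2015), §1 Notation p. 5 (the hermitian pairing `(σ x)ᵀ J y`).
-/

set_option autoImplicit false

namespace Literature.NumberTheory.Automorphic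

namespace UnitaryGroup

open _root_.Matrix QuadraticCoordinates Literature.RepresentationTheory.HeisenbergGroup

/-! ## §1 Algebra of the hermitian pairing -/

section HermFormAlgebra

variable {S : Type*} [CommRing S] {n : Type*} [Fintype n] (σ : S →+* S) (H : Matrix n n S)

/-- sums in the second variable. [cite: Mok2014, §1 Notation p. 5] -/
theorem hermForm_sum_right {ι : Type*} (s : Finset ι) (x : n → S) (y : ι → n → S) :
    hermForm σ H x (∑ j ∈ s, y j) = ∑ j ∈ s, hermForm σ H x (y j) := by
  classical
  induction s using Finset.induction_on with
  | empty => rw [Finset.sum_empty, Finset.sum_empty, hermForm_zero_right]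
  | @insert j s hj ih => rw [Finset.sum_insert hj, Finset.sum_insert hj, hermForm_add_right, ih]

/-- sums in the first variable. [cite: Mok2014, §1 Notation p. 5] -/
theorem hermForm_sum_left {ι : Type*} (s : Finset ι) (x : ι → n → S) (y : n → S) :
    hermForm σ H (∑ j ∈ s, x j) y = ∑ j ∈ s, hermForm σ H (x j) y := by
  classical
  induction s using Finset.induction_on with
  | empty => rw [Finset.sum_empty, Finset.sum_empty, hermForm_zero_left]
  | @insert j s hj ih => rw [Finset.sum_insert hj, Finset.sum_insert hj, hermForm_add_left, ih]

/-- **hermitian symmetry** `h(y, x) = σ h(x, y)` for a `σ`-fixed SYMMETRIC form matrix and an involution `σ`.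
[cite: Mok2014, §1 Notation p. 5] -/
theorem hermForm_swap (hσσ : ∀ z, σ (σ z) = z) (hHσ : ∀ i j, σ (H i j) = H i j) (hHt : H.IsSymm) (x y : n → S) :
    hermForm σ H y x = σ (hermForm σ H x y) := by
  have hHt' : ∀ i j, H j i = H i j := fun i j => by
    simpa only [Matrix.transpose_apply] using congrFun (congrFun hHt i) j
  simp only [hermForm, dotProduct, mulVec, Function.comp_apply, map_sum, map_mul, hσσ, hHσ, Finset.mul_sum]
  rw [Finset.sum_comm]
  exact Finset.sum_congr rfl fun i _ => Finset.sum_congr rfl fun j _ => by rw [hHt' i j]; ring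

end HermFormAlgebra

/-! ## §2 The adapted symplectic chart -/

namespace IsQuadraticCoordinates

section Chart

variable {R S : Type*} [Field R] [CommRing S]
variable {φ : R →+* S} {Ψ : (R × R) ≃+ S} {δ : S} {d : R} (h : IsQuadraticCoordinates φ Ψ δ d)
variable {n : Type*} [Fintype n] [DecidableEq n]
include h

/-- `im(σ(z) w) = re z · im w - im z · re w`. [cite: GelbartRogawski1991, §3.1 p. 454] -/
theorem im_conj_mul {σ : S →+* S} (hσφ : ∀ a, σ (φ a) = φ a) (hσδ : σ δ = -δ) (z w : S) :
    im Ψ (σ z * w) = re Ψ z * im Ψ w - im Ψ z * re Ψ w := by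
  rw [h.im_mul, h.re_conj hσφ hσδ, h.im_conj hσφ hσδ]
  ring

/-- `Ψ(r a, r b) = φ r · Ψ(a, b)`. [cite: GelbartRogawski1991, §3.1 p. 454] -/
theorem apply_smul (r a b : R) : Ψ (r * a, r * b) = φ r * Ψ (a, b) := by
  rw [h.apply, h.apply, map_mul, map_mul]
  ring

omit [Fintype n] [DecidableEq n] in
/-- `reIm⁻¹ (r • w) = φ r • reIm⁻¹ w`. [cite: GelbartRogawski1991, §3.1 p. 454] -/
private theorem reIm_symm_smul' (r : R) (w : (n → R) × (n → R)) :
    (reIm Ψ n).symm (r • w) = φ r • (reIm Ψ n).symm w := by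
  funext i
  simp only [reIm_symm_apply, Prod.smul_fst, Prod.smul_snd, Pi.smul_apply, smul_eq_mul, h.apply_smul]

/-- **THE ADAPTED SYMPLECTIC CHART.**  Given a hyperbolic frame `(x₀, y₀, b, a)` of `(Sⁿ, B)`, `B = hermForm σ (T ⊗ 1)`,
there is an `R`-linear isomorphism `Γ : Rⁿ × Rⁿ ≃ R^ι × R^ι` (`ι = Fin 2 ⊔ Fin m`) with
`Γ(reIm v) = ((re B(x₀,v), im B(x₀,v)) ⊔ (aⱼ⁻¹ re B(bⱼ,v)) ; (im B(y₀,v), -re B(y₀,v)) ⊔ (im B(bⱼ,v)))` which carries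
`alt (polar β_T)` to the standard form `alt (polar ⟨·,·⟩)`. [cite: MoeglinVignerasWaldspurger1987, Chap. 3 §IV.2] -/
theorem exists_frameChart {T : Matrix n n R} (hT : T.IsSymm) {σ : S →+* S} (hσφ : ∀ a, σ (φ a) = φ a)
    (hσδ : σ δ = -δ) (hσσ : ∀ z, σ (σ z) = z) {m : ℕ} {x₀ y₀ : n → S} {b : Fin m → n → S} {a : Fin m → R}
    (hx : hermForm σ (T.map φ) x₀ x₀ = 0) (hy : hermForm σ (T.map φ) y₀ y₀ = 0) (hxy : hermForm σ (T.map φ) x₀ y₀ = 1)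
    (hxb : ∀ j, hermForm σ (T.map φ) x₀ (b j) = 0) (hyb : ∀ j, hermForm σ (T.map φ) y₀ (b j) = 0)
    (hbb : ∀ j j', j ≠ j' → hermForm σ (T.map φ) (b j) (b j') = 0) (hba : ∀ j, hermForm σ (T.map φ) (b j) (b j) = φ (a j))
    (ha : ∀ j, a j ≠ 0)
    (hexp : ∀ v : n → S, v = hermForm σ (T.map φ) y₀ v • x₀ + hermForm σ (T.map φ) x₀ v • y₀ +
      ∑ j, (φ (a j)⁻¹ * hermForm σ (T.map φ) (b j) v) • b j) :
    ∃ Γ : ((n → R) × (n → R)) ≃ₗ[R] (((Fin 2 ⊕ Fin m) → R) × ((Fin 2 ⊕ Fin m) → R)),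
      (∀ v : n → S, Γ (reIm Ψ n v) =
        (Sum.elim ![re Ψ (hermForm σ (T.map φ) x₀ v), im Ψ (hermForm σ (T.map φ) x₀ v)]
            (fun j => (a j)⁻¹ * re Ψ (hermForm σ (T.map φ) (b j) v)),
          Sum.elim ![im Ψ (hermForm σ (T.map φ) y₀ v), -re Ψ (hermForm σ (T.map φ) y₀ v)]
            (fun j => im Ψ (hermForm σ (T.map φ) (b j) v)))) ∧
      (∀ (x y : (Fin 2 ⊕ Fin m) → R), Γ.symm (x, y) = reIm Ψ n
        (Ψ (x (Sum.inl 0), x (Sum.inl 1)) • y₀ + (φ (y (Sum.inl 0)) * δ - φ (y (Sum.inl 1))) • x₀ +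
          ∑ j, Ψ (x (Sum.inr j), (a j)⁻¹ * y (Sum.inr j)) • b j)) ∧
      ∀ w w' : (n → R) × (n → R),
        alt (polar (dotProductBilin R R (m := Fin 2 ⊕ Fin m))) (Γ w) (Γ w') =
          alt (polar (Matrix.toLinearMap₂' R T)) w w' := by
  classical
  -- abbreviations
  set B : (n → S) → (n → S) → S := hermForm σ (T.map φ) with hB
  have hHσ : ∀ i j, σ ((T.map φ) i j) = (T.map φ) i j := fun i j => by rw [Matrix.map_apply, hσφ]
  have hHt : (T.map φ).IsSymm := hT.map _
  have hswap : ∀ x y, B y x = σ (B x y) := fun x y => hermForm_swap σ (T.map φ) hσσ hHσ hHt x y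
  have hyx : B y₀ x₀ = 1 := by rw [hswap, hxy, map_one]
  have hbx : ∀ j, B (b j) x₀ = 0 := fun j => by rw [hswap, hxb, map_zero]
  have hby : ∀ j, B (b j) y₀ = 0 := fun j => by rw [hswap, hyb, map_zero]
  -- the forward map on `Sⁿ`
  let GX : (n → S) → (Fin 2 ⊕ Fin m) → R := fun v =>
    Sum.elim ![re Ψ (B x₀ v), im Ψ (B x₀ v)] (fun j => (a j)⁻¹ * re Ψ (B (b j) v))
  let GY : (n → S) → (Fin 2 ⊕ Fin m) → R := fun v =>
    Sum.elim ![im Ψ (B y₀ v), -re Ψ (B y₀ v)] (fun j => im Ψ (B (b j) v))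
  -- the inverse vector
  let vec : ((Fin 2 ⊕ Fin m) → R) → ((Fin 2 ⊕ Fin m) → R) → (n → S) := fun x y =>
    Ψ (x (Sum.inl 0), x (Sum.inl 1)) • y₀ + (φ (y (Sum.inl 0)) * δ - φ (y (Sum.inl 1))) • x₀ +
      ∑ j, Ψ (x (Sum.inr j), (a j)⁻¹ * y (Sum.inr j)) • b j
  -- linearity of `B z` on frame combinations
  have hlin : ∀ (z : n → S) (c₁ c₂ : S) (c : Fin m → S),
      B z (c₁ • y₀ + c₂ • x₀ + ∑ j, c j • b j) = c₁ * B z y₀ + c₂ * B z x₀ + ∑ j, c j * B z (b j) := by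
    intro z c₁ c₂ c
    rw [hB, hermForm_add_right, hermForm_add_right, hermForm_smul_right, hermForm_smul_right, hermForm_sum_right]
    simp only [hermForm_smul_right]
  -- pairings of the inverse vector with the frame
  have hvx : ∀ x y, B x₀ (vec x y) = Ψ (x (Sum.inl 0), x (Sum.inl 1)) := by
    intro x y
    show B x₀ (_ • y₀ + _ • x₀ + ∑ j, _ • b j) = _
    rw [hlin, hxy, hx, mul_one, mul_zero, add_zero]
    simp only [hxb, mul_zero, Finset.sum_const_zero, add_zero]
  have hvy : ∀ x y, B y₀ (vec x y) = φ (y (Sum.inl 0)) * δ - φ (y (Sum.inl 1)) := by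
    intro x y
    show B y₀ (_ • y₀ + _ • x₀ + ∑ j, _ • b j) = _
    rw [hlin, hy, hyx, mul_zero, zero_add, mul_one]
    simp only [hyb, mul_zero, Finset.sum_const_zero, add_zero]
  have hvb : ∀ x y j, B (b j) (vec x y) = φ (a j) * Ψ (x (Sum.inr j), (a j)⁻¹ * y (Sum.inr j)) := by
    intro x y j
    show B (b j) (_ • y₀ + _ • x₀ + ∑ j, _ • b j) = _
    rw [hlin, hby, hbx, mul_zero, mul_zero, zero_add, zero_add, Finset.sum_eq_single j]
    · rw [hba, mul_comm]
    · intro j' _ hj'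
      rw [hbb j j' (Ne.symm hj'), mul_zero]
    · intro hj; exact absurd (Finset.mem_univ j) hj
  -- `Γ ∘ Γ⁻¹ = id`
  have hright : ∀ x y, (GX (vec x y), GY (vec x y)) = (x, y) := by
    intro x y
    refine Prod.ext (funext fun i => ?_) (funext fun i => ?_)
    · rcases i with i | j
      · fin_cases i
        · show re Ψ (B x₀ (vec x y)) = x (Sum.inl 0)
          rw [hvx, re_apply]
        · show im Ψ (B x₀ (vec x y)) = x (Sum.inl 1)
          rw [hvx, im_apply]
      · show (a j)⁻¹ * re Ψ (B (b j) (vec x y)) = x (Sum.inr j)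
        rw [hvb, h.re_map_mul, re_apply, ← mul_assoc, inv_mul_cancel₀ (ha j), one_mul]
    · rcases i with i | j
      · fin_cases i
        · show im Ψ (B y₀ (vec x y)) = y (Sum.inl 0)
          rw [hvy, map_sub, h.im_mul, h.re_map, h.im_map, h.im_delta, h.re_delta, h.im_map]
          ring
        · show -re Ψ (B y₀ (vec x y)) = y (Sum.inl 1)
          rw [hvy, map_sub, h.re_mul, h.re_map, h.im_map, h.re_delta, h.im_delta, h.re_map]
          ring
      · show im Ψ (B (b j) (vec x y)) = y (Sum.inr j)
        rw [hvb, h.im_map_mul, im_apply, ← mul_assoc, mul_inv_cancel₀ (ha j), one_mul]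
  -- `Γ⁻¹ ∘ Γ = id`
  have hleft : ∀ v : n → S, vec (GX v) (GY v) = v := by
    intro v
    have e1 : Ψ (GX v (Sum.inl 0), GX v (Sum.inl 1)) = B x₀ v := by
      show Ψ (re Ψ (B x₀ v), im Ψ (B x₀ v)) = B x₀ v
      exact apply_re_im Ψ _
    have e2 : φ (GY v (Sum.inl 0)) * δ - φ (GY v (Sum.inl 1)) = B y₀ v := by
      show φ (im Ψ (B y₀ v)) * δ - φ (-re Ψ (B y₀ v)) = B y₀ v
      rw [map_neg, sub_neg_eq_add, add_comm, h.re_add_im]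
    have e3 : ∀ j, Ψ (GX v (Sum.inr j), (a j)⁻¹ * GY v (Sum.inr j)) = φ (a j)⁻¹ * B (b j) v := by
      intro j
      show Ψ ((a j)⁻¹ * re Ψ (B (b j) v), (a j)⁻¹ * im Ψ (B (b j) v)) = φ (a j)⁻¹ * B (b j) v
      rw [h.apply_smul, apply_re_im]
    conv_rhs => rw [hexp v]
    simp only [vec, e1, e2, e3]
    abel
  refine ⟨{ toFun := fun w => (GX ((reIm Ψ n).symm w), GY ((reIm Ψ n).symm w))
            invFun := fun p => reIm Ψ n (vec p.1 p.2)
            map_add' := fun w w' => ?_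
            map_smul' := fun r w => ?_
            left_inv := fun w => ?_
            right_inv := fun p => ?_ }, fun v => ?_, fun x y => rfl, ?_⟩
  · -- additivity
    rw [map_add]
    refine Prod.ext (funext fun i => ?_) (funext fun i => ?_)
    · rcases i with i | j
      · fin_cases i <;> simp [GX, hB, hermForm_add_right]
      · simp [GX, hB, hermForm_add_right, mul_add]
    · rcases i with i | j
      · fin_cases i
        · simp [GY, hB, hermForm_add_right]
        · simp [GY, hB, hermForm_add_right]
          ring
      · simp [GY, hB, hermForm_add_right]
  · -- homogeneity
    rw [RingHom.id_apply, h.reIm_symm_smul']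
    refine Prod.ext (funext fun i => ?_) (funext fun i => ?_)
    · rcases i with i | j
      · fin_cases i <;> simp [GX, hB, hermForm_smul_right, h.re_map_mul, h.im_map_mul]
      · simp [GX, hB, hermForm_smul_right, h.re_map_mul]; ring
    · rcases i with i | j
      · fin_cases i
        · simp [GY, hB, hermForm_smul_right, h.re_map_mul, h.im_map_mul]
        · simp [GY, hB, hermForm_smul_right, h.re_map_mul, h.im_map_mul]
      · simp [GY, hB, hermForm_smul_right, h.im_map_mul]
  · -- left inverse
    show reIm Ψ n (vec (GX ((reIm Ψ n).symm w)) (GY ((reIm Ψ n).symm w))) = w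
    rw [hleft, AddEquiv.apply_symm_apply]
  · -- right inverse
    show (GX ((reIm Ψ n).symm (reIm Ψ n (vec p.1 p.2))), GY ((reIm Ψ n).symm (reIm Ψ n (vec p.1 p.2)))) = p
    rw [AddEquiv.symm_apply_apply, hright]
  · -- the formula on `reIm v`
    show (GX ((reIm Ψ n).symm (reIm Ψ n v)), GY ((reIm Ψ n).symm (reIm Ψ n v))) = _
    rw [AddEquiv.symm_apply_apply]
  · -- symplecticity
    intro w w'
    obtain ⟨v, rfl⟩ : ∃ v, reIm Ψ n v = w := ⟨(reIm Ψ n).symm w, (reIm Ψ n).apply_symm_apply w⟩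
    obtain ⟨v', rfl⟩ : ∃ v', reIm Ψ n v' = w' := ⟨(reIm Ψ n).symm w', (reIm Ψ n).apply_symm_apply w'⟩
    rw [← h.im_hermForm_map n hT hσφ hσδ v v']
    show alt (polar (dotProductBilin R R (m := Fin 2 ⊕ Fin m)))
        (GX ((reIm Ψ n).symm (reIm Ψ n v)), GY ((reIm Ψ n).symm (reIm Ψ n v)))
        (GX ((reIm Ψ n).symm (reIm Ψ n v')), GY ((reIm Ψ n).symm (reIm Ψ n v'))) = im Ψ (B v v')
    rw [AddEquiv.symm_apply_apply, AddEquiv.symm_apply_apply]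
    -- expand `B v v'` along the frame in the first variable
    have hBvv' : B v v' = σ (B y₀ v) * B x₀ v' + σ (B x₀ v) * B y₀ v' +
        ∑ j, σ (φ (a j)⁻¹ * B (b j) v) * B (b j) v' := by
      conv_lhs => rw [hexp v]
      rw [hB, hermForm_add_left, hermForm_add_left, hermForm_smul_left_eq, hermForm_smul_left_eq, hermForm_sum_left]
      simp only [hermForm_smul_left_eq]
    rw [hBvv', map_add, map_add, map_sum]
    simp only [map_mul, hσφ, h.im_conj_mul hσφ hσδ, alt_apply, polar_apply, dotProductBilin_apply_apply, dotProduct,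
      Fintype.sum_sum_type, Fin.sum_univ_two, GX, GY, Sum.elim_inl, Sum.elim_inr, Matrix.cons_val_zero,
      Matrix.cons_val_one]
    have e : ∀ j, im Ψ (φ (a j)⁻¹ * σ (B (b j) v) * B (b j) v') =
        (a j)⁻¹ * re Ψ (B (b j) v) * im Ψ (B (b j) v') - (a j)⁻¹ * re Ψ (B (b j) v') * im Ψ (B (b j) v) := by
      intro j
      rw [mul_assoc, h.im_map_mul, h.im_conj_mul hσφ hσδ]
      ring
    simp only [e, Finset.sum_sub_distrib]
    ring

end Chart

end IsQuadraticCoordinates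

end UnitaryGroup

end Literature.NumberTheory.Automorphic
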